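import Summits.ValiantsHypothesis.ValiantsHypothesis.Theorems.FifoMatchingNNDivisionHardMaxCutLP
import Summits.ValiantsHypothesis.ValiantsHypothesis.Theorems.FifoMatchingNNDivisionHardCorSandwich

/-!
# FifoMatching · NNDivisionHard — MAX-CUT LP classes, part 2/4: §5 the Literature-shaped block `KMR` (`LPRelaxation`, `MaxCutLPGapHard`) and the bridge `toKMR`, classes K / K_θ decided GIVEN `KMR.MaxCutLPGapHard`

Theorems-grade port (bytes staged by val-idea-43 g5 for a port hand) of §3g `…Cruxes.NNDivisionHard.VirtualPassenger.MaxCutLP43` of the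
registered LINE `Cruxes/NNDivisionHard/Lines/virtual_passenger.lean` rev 18 @21a5fb60d209 (pen val-idea-42 g2), lines 977–1784 — statements and
proofs VERBATIM (author of the block: val-idea-43 g2/g3, card `maxcut-relaxation`, kernel `MaxCutLPSketch.lean` rev 3.3; pen intakes rev 9 / 13 / 15);
edits: namespace `…Theorems.FifoMatching.MaxCutLP`, `T` a local abbrev δ-equal to `XcDivision.T`, 30 helper docstrings, split in four parts for
the 400-line cap.  Purpose: free ≈ 46 KB of the line's 200 KB workfile budget (pen's BYTES NOTE 2026-08-28T23:26:44Z); after landing the line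
replaces §3g by `import` + `open …MaxCutLP` (names unchanged below the namespace).
-/

set_option linter.dupNamespace false

namespace Summit.ValiantsHypothesis.ValiantsHypothesis.Theorems.FifoMatching.MaxCutLP

open Matrix Finset
open scoped Pointwise
open Literature.Barriers.PneNP (HasEFOfSize)
open Literature.Combinatorics.Optimization (corPolytopeGraph corVec)

variable {h : ℕ}

/-! ### §3g (cont., REV 13) val-idea-43 g3's `MaxCutLPSketch.lean` (rev 3 @1a592a7a76c0; = §5–§6d of rev 3.2) — the KMR … ⟨abr.⟩ -/

open Filter Topology

/-! ## §5 P1 (crit-9 VERDICT #9): the PORT-READY Literature block `KMR` and the bridge … ⟨abr.⟩ -/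

namespace KMR

/-- value of the cut `b : Fin n → Bool` under a weighting `w` of ORDERED pairs: `Σ_{i,j} w i j · [b i ≠ b j]` (MAX … ⟨abr.⟩ -/
def cutValue {n : ℕ} (w : Fin n → Fin n → ℝ) (b : Fin n → Bool) : ℝ :=
  ∑ i, ∑ j, if b i = b j then 0 else w i j

/-- the optimum `opt(w) = max_b cutValue w b`. -/
noncomputable def maxCutValue {n : ℕ} (w : Fin n → Fin n → ℝ) : ℝ :=
  (Finset.univ : Finset (Fin n → Bool)).sup' ⟨fun _ => false, Finset.mem_univ _⟩ (cutValue w)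

/-- **LP relaxation of MAX-CUT on `n` vertices** in the sense of Chan–Lee–Raghavendra–Steurer: a LINEARISATION in … ⟨abr.⟩ -/
structure LPRelaxation (n : ℕ) (D : Type) [Fintype D] where
  /-- the linearised cuts `ỹ_b` -/
  pt : (Fin n → Bool) → D → ℝ
  /-- the linearised instances `w̃` -/
  obj : (Fin n → Fin n → ℝ) → D → ℝ
  /-- the feasible region `P` -/
  feasible : Set (D → ℝ)
  /-- `⟨w̃, ỹ_b⟩ = w(b)` for every nonnegative instance and every cut -/
  consistent : ∀ w : Fin n → Fin n → ℝ, (∀ i j, 0 ≤ w i j) → ∀ b, obj w ⬝ᵥ pt b = cutValue w b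
  /-- `ỹ_b ∈ P` -/
  contains : ∀ b, pt b ∈ feasible

/-- the relaxation has INTEGRALITY GAP AT MOST `α`: its LP value is `≤ α · opt(w)` on every nonnegative instance ( … ⟨abr.⟩ -/
def LPRelaxation.GapLE {n : ℕ} {D : Type} [Fintype D] (L : LPRelaxation n D) (α : ℝ) : Prop :=
  ∀ w : Fin n → Fin n → ℝ, (∀ i j, 0 ≤ w i j) → ∀ y ∈ L.feasible, L.obj w ⬝ᵥ y ≤ α * maxCutValue w

/-- the relaxation has SIZE AT MOST `R`: the feasible region is the projection of a slack-form system with `R` ine … ⟨abr.⟩ -/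
def LPRelaxation.SizeLE {n : ℕ} {D : Type} [Fintype D] (L : LPRelaxation n D) (R : ℕ) : Prop :=
  HasEFOfSize L.feasible R

/-- **named fact `MaxCutLPGapHard` (Kothari–Meka–Raghavendra: weakly-exponential LPs do not beat gap 2 for MAX-CUT … ⟨abr.⟩ -/
def MaxCutLPGapHard : Prop :=
  ∀ ε : ℝ, 0 < ε → ∃ c : ℝ, 0 < c ∧ ∃ n₀ : ℕ, ∀ n ≥ n₀, ∀ (D : Type) [Fintype D] (L : LPRelaxation n D) (R : ℕ),
    L.GapLE (2 - ε) → L.SizeLE R → (2 : ℝ) ^ ((n : ℝ) ^ c) ≤ R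

/-- constant cuts have value `0`. -/
theorem cutValue_const {n : ℕ} (w : Fin n → Fin n → ℝ) (c : Bool) : cutValue w (fun _ => c) = 0 := by
  simp [cutValue]

/-- the max-cut value is nonnegative. -/
theorem maxCutValue_nonneg {n : ℕ} (w : Fin n → Fin n → ℝ) : 0 ≤ maxCutValue w := by
  rw [← cutValue_const w false]
  exact Finset.le_sup' (cutValue w) (Finset.mem_univ _)

/-- monotonicity of the gap bound in the ratio. -/
theorem LPRelaxation.GapLE.mono {n : ℕ} {D : Type} [Fintype D] {L : LPRelaxation n D} {α β : ℝ} (h : L.GapLE α)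
    (hαβ : α ≤ β) : L.GapLE β :=
  fun w hw y hy => (h w hw y hy).trans (mul_le_mul_of_nonneg_right hαβ (maxCutValue_nonneg w))

end KMR

/-! ### the bridge -/

-- `polylog_lt_rpow_eventually` is ✓ `CorSandwich.polylog_lt_rpow_eventually` (Theorems/FifoMatchingNNDivisionHardCorSandwich.lean);
-- the copy staged here was dropped at the gate's dedup (val-port-4 g3, flag-only).

/-- the Laplacian functional `L_w` as a VECTOR (for the CLRS linearisation). -/
def lapVec (w : Fin h × Fin h → ℝ) : Fin h × Fin h → ℝ :=
  fun p => ∑ i, ∑ j, wOff w i j * cutDirG i j p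

/-- `lapVec w ⬝ y = lapVal w y`. -/
theorem lapVec_dotProduct (w y : Fin h × Fin h → ℝ) : lapVec w ⬝ᵥ y = lapVal w y := by
  simp only [lapVec, dotProduct, lapVal, Finset.sum_mul, mul_assoc]
  rw [Finset.sum_comm]
  refine Finset.sum_congr rfl fun i _ => ?_
  rw [Finset.sum_comm]
  refine Finset.sum_congr rfl fun j _ => ?_
  rw [Finset.mul_sum]

/-- dictionary: KMR's `cutValue` of a curried weighting is the line's `cutVal`. -/
theorem cutValue_eq_cutVal (w : Fin h × Fin h → ℝ) (b : Fin h → Bool) :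
    KMR.cutValue (fun i j => w (i, j)) b = cutVal w b := by
  unfold KMR.cutValue cutVal lapVal
  refine Finset.sum_congr rfl fun i _ => Finset.sum_congr rfl fun j _ => ?_
  by_cases hij : i = j
  · subst hij; simp [wOff]
  · rw [cutDirG_dot_corVec i j hij, wOff, if_neg hij]
    split_ifs <;> simp

/-- dictionary: KMR's `maxCutValue` of a curried weighting is the line's `maxCut`. -/
theorem maxCutValue_eq_maxCut (w : Fin h × Fin h → ℝ) : KMR.maxCutValue (fun i j => w (i, j)) = maxCut w := by
  unfold KMR.maxCutValue maxCut
  exact Finset.sup'_congr _ rfl fun b _ => cutValue_eq_cutVal w b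

/-- ★ an `IsMaxCutApprox θ` region IS a CLRS relaxation (linearisation `bbᵀ`, objective `lapVec w`) of gap `≤ 1 + θ`. -/
noncomputable def toKMR {θ : ℝ} {R : Set (Fin h × Fin h → ℝ)} (hR : IsMaxCutApprox θ R) :
    KMR.LPRelaxation h (Fin h × Fin h) where
  pt := fun b => corVec (⊤ : SimpleGraph (Fin h)) b
  obj := fun w => lapVec (fun p => w p.1 p.2)
  feasible := R
  consistent := by
    intro w _ b
    rw [lapVec_dotProduct]
    exact (cutValue_eq_cutVal (fun p => w p.1 p.2) b).symm
  contains := fun b => hR.1 (subset_convexHull ℝ _ ⟨b, rfl⟩)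

/-- the translated relaxation has integrality gap `≤ 1 + θ`. -/
theorem toKMR_gapLE {θ : ℝ} {R : Set (Fin h × Fin h → ℝ)} (hR : IsMaxCutApprox θ R) :
    (toKMR hR).GapLE (1 + θ) := by
  intro w hw y hy
  have h1 := hR.2 (fun p => w p.1 p.2) (fun p => hw p.1 p.2) y hy
  have h2 : KMR.maxCutValue w = maxCut (fun p : Fin h × Fin h => w p.1 p.2) := by
    have := maxCutValue_eq_maxCut (h := h) (fun p => w p.1 p.2)
    simpa using this
  change lapVec (fun p => w p.1 p.2) ⬝ᵥ y ≤ (1 + θ) * KMR.maxCutValue w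
  rw [lapVec_dotProduct, h2]
  exact h1

/-- the translated relaxation has the size of the given EF. -/
theorem toKMR_sizeLE {θ : ℝ} {R : Set (Fin h × Fin h → ℝ)} (hR : IsMaxCutApprox θ R) {r : ℕ}
    (hEF : HasEFOfSize R r) : (toKMR hR).SizeLE r := hEF

/-- `T c h < r` from `2^{h^{c₃}} ≤ r`, eventually. -/
theorem T_lt_of_kmr_bound (c : ℕ) {c₃ : ℝ} (hc₃ : 0 < c₃) :
    ∃ h₀ : ℕ, ∀ h ≥ h₀, ∀ r : ℕ, (2 : ℝ) ^ ((h : ℝ) ^ c₃) ≤ r → T c h < r := by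
  obtain ⟨h₀, hh₀⟩ := CorSandwich.polylog_lt_rpow_eventually c hc₃
  refine ⟨h₀, fun h hh r hr => ?_⟩
  have hlt : (((Nat.log 2 h + c) ^ c : ℕ) : ℝ) < (h : ℝ) ^ c₃ := hh₀ h hh
  have hT : ((T c h : ℕ) : ℝ) = (2 : ℝ) ^ ((((Nat.log 2 h + c) ^ c : ℕ) : ℝ)) := by
    rw [Real.rpow_natCast]; push_cast; rfl
  have h2 : (2 : ℝ) ^ ((((Nat.log 2 h + c) ^ c : ℕ) : ℝ)) < (2 : ℝ) ^ ((h : ℝ) ^ c₃) :=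
    Real.rpow_lt_rpow_of_exponent_lt (by norm_num) hlt
  have : ((T c h : ℕ) : ℝ) < r := by rw [hT]; exact lt_of_lt_of_le h2 hr
  exact_mod_cast this

/-- ★★ **the bridge (exact form)**: the Literature fact implies the sketch's named consequence. -/
theorem maxCutLPApproxHard_of_kmr (hK : KMR.MaxCutLPGapHard) : MaxCutLPApproxHard := by
  intro θ hθ c
  obtain ⟨c₃, hc₃, n₀, hn₀⟩ := hK (1 - θ) (by linarith)
  obtain ⟨h₁, hh₁⟩ := T_lt_of_kmr_bound c hc₃
  refine ⟨max n₀ h₁, fun h hh R r hR hEF => ?_⟩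
  have hn : n₀ ≤ h := le_trans (le_max_left _ _) hh
  have hh1 : h₁ ≤ h := le_trans (le_max_right _ _) hh
  have hgap : (toKMR hR).GapLE (2 - (1 - θ)) := (toKMR_gapLE hR).mono (by linarith)
  exact hh₁ h hh1 r (hn₀ h hn _ (toKMR hR) r hgap (toKMR_sizeLE hR hEF))

/-- ★★ **the bridge**: `KMR.MaxCutLPGapHard → MaxCutLPHard`; hence `cutDominant_decided (maxCutLPHard_of_kmr hK)`. -/
theorem maxCutLPHard_of_kmr (hK : KMR.MaxCutLPGapHard) : MaxCutLPHard :=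
  maxCutLPHard_of_approx (maxCutLPApproxHard_of_kmr hK)

/-- the decided-class theorem restated against the Literature fact. -/
theorem cutDominant_decided_kmr (hK : KMR.MaxCutLPGapHard) :
    ∀ c : ℕ, ∃ h₀ : ℕ, ∀ h ≥ h₀, ∀ (K : ℕ) (q : Fin (K + 1) → (Fin h × Fin h → ℝ)) (r : ℕ),
      CutDominant h q →
      HasEFOfSize (corPolytopeGraph (⊤ : SimpleGraph (Fin h)) + convexHull ℝ (Set.range q)) r → T c h < r :=
  cutDominant_decided (maxCutLPHard_of_kmr hK)

/-- CLASS `K_θ` (gap-thin, `θ < 1`) is decided, given `KMR.MaxCutLPGapHard`. -/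
theorem gapThin_decided_kmr (hK : KMR.MaxCutLPGapHard) (θ : ℝ) (hθ : θ < 1) :
    ∀ c : ℕ, ∃ h₀ : ℕ, ∀ h ≥ h₀, ∀ (K : ℕ) (q : Fin (K + 1) → (Fin h × Fin h → ℝ)) (r : ℕ),
      GapThin θ h q →
      HasEFOfSize (corPolytopeGraph (⊤ : SimpleGraph (Fin h)) + convexHull ℝ (Set.range q)) r → T c h < r :=
  gapThin_decided (maxCutLPApproxHard_of_kmr hK) θ hθ

end Summit.ValiantsHypothesis.ValiantsHypothesis.Theorems.FifoMatching.MaxCutLP
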